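import Summits.HodgeConjecture.HodgeConjecture.Theorems.Ring2AbelianAllWeilSquarefree
import Summits.HodgeConjecture.HodgeConjecture.Theorems.Ring2AbelianAllWeilColumn
import HarnessLib

/-!
# Ring 2 · AbelianAll (ab-weil-1, gen 4, file C) — squarefree discriminants suffice on every
  imaginary-quadratic Weil rung

research route, not a corollary; conditional on HC_CM plus one named minimal statement.
Cell line: research route conditional on HC_CM; not a corollary; Q11.4-sentence-2 already refuted in dim ≥ 3.
`HC_CM` (`Theses.RankFourFaces.CMAbelianHodge`) does not occur in this file. No case of the Hodge
conjecture is claimed: every statement below is an EQUIVALENCE between two open statements, or an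
implication between them.

By `weilAlgebraicAll_sq_mul : m ≠ 0 → WeilAlgebraicAll n d → WeilAlgebraicAll n (m²d)` (file B,
`Ring2AbelianAllWeilSquarefree`, from the isogeny descent of file A) the Weil field `K = ℚ(√-d)`, not the
integer `d` with `φ² = -d`, is what the imaginary-quadratic Weil statements depend on. Recorded here BY NAME
for the rungs other seats cite (hweil `WeilTypeLadder`, weil-2, motiv):

* `forall_weilAlgebraicAll_iff_squarefree` — `(∀ d ≥ 1, WeilAlgebraicAll n d) ↔ (∀ squarefree d ≥ 1, …)`;
* R∞ `WeilTypeLadder.WeilClassesImaginaryQuadratic` `↔ ∀ n ≥ 2, ∀ squarefree d ≥ 1, WeilAlgebraicAll n d`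
  (`weilClassesImaginaryQuadratic_iff_squarefree`);
* W₆ `Theses.SevenfoldWeilCensus.WeilSixfolds` (stmt-HodgeConjecture-2524) `↔ ∀ squarefree d ≥ 1, WeilAlgebraicAll 3 d`
  (`weilSixfolds_iff_squarefree`);
* F1 `Markman2025_weilClasses_algebraic_abelianFourfold` (the fourfold STATEMENT, a `def`, never asserted)
  `↔ ∀ squarefree d ≥ 1, WeilAlgebraicAll 2 d` (`markmanFourfolds_iff_squarefree`);
* one squarefree `d₀` closes the whole square class: `weilAlgebraicAll_sq_class_of_one`.

NOT covered (deliberately): the HYPERBOLIC / NON-SPLIT rungs (`NonsplitSixfolds`, `SplitEightfolds`,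
`SplitWeilAbelianVarieties`, the `…hyperbolicSixfold` facts) — their hypotheses name a polarization class
through `IsHyperbolicWeilType`, whose transport along the descent isogeny is not proved here.

## References
* B. Moonen, Yu. Zarhin, *Weil classes on abelian varieties*, Crelle 496 (1998), §1. [MoonenZarhin1998WeilClasses]
* B. van Geemen, *An introduction to the Hodge conjecture for abelian varieties*, LNM 1594 (1994), 4.9–4.12, 6.12. [vanGeemen1994HodgeAV]
* D. Mumford, *Abelian varieties* (1970), §7 Thm. 4, §19 Thm. 3. [MumfordAV1970]
-/

noncomputable section

-- every declaration of this problem lives in `Summit.HodgeConjecture.HodgeConjecture.…` (single-problem summit)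
set_option linter.dupNamespace false

namespace Summit.HodgeConjecture.HodgeConjecture.Ring2.AbelianAll

open CategoryTheory
open Literature.AlgebraicGeometry Literature.AlgebraicGeometry.Motives
open Literature.AlgebraicGeometry.HodgeTheory
open Summit.HodgeConjecture.HodgeConjecture
open Summit.HodgeConjecture.HodgeConjecture.WeilTypeLadder
open Summit.HodgeConjecture.HodgeConjecture.Cruxes.HodgeAbelianVarieties.EStepSecantInduction
open Summit.HodgeConjecture.HodgeConjecture.Cruxes.HodgeAbelianVarieties.PrymCanonicalZ3SplitSeeds.Stubs

/-- **Squarefree `d` suffice, as an equivalence** (fixed `n`). [cite: MoonenZarhin1998WeilClasses, §1] -/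
theorem forall_weilAlgebraicAll_iff_squarefree (n : ℕ) :
    (∀ d : ℕ, 0 < d → WeilAlgebraicAll n d) ↔ ∀ d : ℕ, 0 < d → Squarefree d → WeilAlgebraicAll n d :=
  ⟨fun h d hd _ ↦ h d hd, weilAlgebraicAll_of_squarefree⟩

/-- **One squarefree `d₀` closes its whole square class**: `WeilAlgebraicAll n d₀ → WeilAlgebraicAll n (m² d₀)`
for every `m ≥ 1` (restatement of `weilAlgebraicAll_sq_mul` in the form weil-2's target list uses: a
construction for `K = ℚ(√-d₀)` at ONE `d₀` is a construction for `d = d₀, 4d₀, 9d₀, …`).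
[cite: MumfordAV1970, §7 Thm. 4 p. 72] -/
theorem weilAlgebraicAll_sq_class_of_one {n d₀ : ℕ} (h : WeilAlgebraicAll n d₀) :
    ∀ m : ℕ, 0 < m → WeilAlgebraicAll n (m ^ 2 * d₀) :=
  fun _ hm ↦ weilAlgebraicAll_sq_mul hm.ne' h

/-! ### R∞ — Weil's question for imaginary quadratic `K` -/

/-- **R∞ from squarefree discriminants.** [cite: vanGeemen1994HodgeAV, 4.9 and proof of Thm. 6.12] -/
theorem weilClassesImaginaryQuadratic_of_squarefree
    (h : ∀ n : ℕ, 2 ≤ n → ∀ d : ℕ, 0 < d → Squarefree d → WeilAlgebraicAll n d) :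
    WeilClassesImaginaryQuadratic :=
  weilClassesImaginaryQuadratic_of_weilClassesAlgebraic
    (WeilSectorOffReach.weilClassesAlgebraic_iff_weilAlgebraicAll.2
      fun n d hn hd ↦ weilAlgebraicAll_of_squarefree (h n hn) d hd)

/-- **R∞ ↔ its squarefree part.** [cite: vanGeemen1994HodgeAV, 4.9 and proof of Thm. 6.12] -/
theorem weilClassesImaginaryQuadratic_iff_squarefree :
    WeilClassesImaginaryQuadratic ↔
      ∀ n : ℕ, 2 ≤ n → ∀ d : ℕ, 0 < d → Squarefree d → WeilAlgebraicAll n d := by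
  refine ⟨fun h n hn d hd _ ↦ ?_, weilClassesImaginaryQuadratic_of_squarefree⟩
  exact WeilSectorOffReach.weilClassesAlgebraic_iff_weilAlgebraicAll.1
    (weilClassesAlgebraic_of_weilClassesImaginaryQuadratic h) n d hn hd

/-! ### W₆ — Weil classes on abelian sixfolds of Weil type (stmt-HodgeConjecture-2524) -/

/-- **W₆ from squarefree discriminants.** [cite: vanGeemen1994HodgeAV, 4.9 and proof of Thm. 6.12] -/
theorem weilSixfolds_of_squarefree (h : ∀ d : ℕ, 0 < d → Squarefree d → WeilAlgebraicAll 3 d) :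
    Theses.SevenfoldWeilCensus.WeilSixfolds :=
  sevenfold_weilSixfolds_iff_tropical.2
    (WeilSectorOffReach.weilSixfolds_iff_weilAlgebraicAll_three.2 (weilAlgebraicAll_of_squarefree h))

/-- **W₆ ↔ its squarefree part.** [cite: vanGeemen1994HodgeAV, 4.9 and proof of Thm. 6.12] -/
theorem weilSixfolds_iff_squarefree :
    Theses.SevenfoldWeilCensus.WeilSixfolds ↔ ∀ d : ℕ, 0 < d → Squarefree d → WeilAlgebraicAll 3 d := by
  refine ⟨fun h d hd _ ↦ ?_, weilSixfolds_of_squarefree⟩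
  exact WeilSectorOffReach.weilSixfolds_iff_weilAlgebraicAll_three.1 (sevenfold_weilSixfolds_iff_tropical.1 h) d hd

/-! ### F1 — Markman's fourfold STATEMENT (a `def`; never asserted here) -/

/-- **F1 ↔ its squarefree part.** [cite: Markman2025SurveySecant, Thm. 1.2 (statement only; preprint)] -/
theorem markmanFourfolds_iff_squarefree :
    Markman2025_weilClasses_algebraic_abelianFourfold ↔
      ∀ d : ℕ, 0 < d → Squarefree d → WeilAlgebraicAll 2 d := by
  rw [← WeilSectorOffReach.weilAlgebraicAll_two_iff_markman]
  exact forall_weilAlgebraicAll_iff_squarefree 2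

/-! ### The fourfold residual: R1′ is the d-squarefree reading of R1, and both sit under R∞ -/

/-- **R∞ ⟹ R1′** (through R1, `weilFourfoldResidual_of_weilClassesImaginaryQuadratic`). [cite: vanGeemen1994HodgeAV, 4.9–4.12] -/
theorem weilFourfoldResidualSq_of_weilClassesImaginaryQuadratic (h : WeilClassesImaginaryQuadratic) :
    WeilFourfoldResidualSq :=
  weilFourfoldResidualSq_of_weilFourfoldResidual (weilFourfoldResidual_of_weilClassesImaginaryQuadratic h)

/-- **W₆ ⟹ R1′** (through the d-slices, `weilFourfoldResidual_of_markmanSixfolds` pattern: sixfolds ⟹ fourfolds by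
Schoen's transfer, a tree theorem). [cite: Schoen1998HodgeWeilAddendum, §10 (Proposition)] -/
theorem weilFourfoldResidualSq_of_weilSixfolds (h : Theses.SevenfoldWeilCensus.WeilSixfolds) :
    WeilFourfoldResidualSq := by
  have h3 : ∀ d : ℕ, 0 < d → WeilAlgebraicAll 3 d :=
    WeilSectorOffReach.weilSixfolds_iff_weilAlgebraicAll_three.1 (sevenfold_weilSixfolds_iff_tropical.1 h)
  intro d hd _ _ _ δ _
  -- all sixfolds ⟹ split sixfolds (hyperplane convention) ⟹ all fourfolds (Schoen descent, `stub_descend 2 d`)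
  have h2 : WeilAlgebraicAll 2 d :=
    Cruxes.HodgeAbelianVarieties.PrymCanonicalZ3SplitSeeds.Stubs.Descend.stub_descend 2 d le_rfl hd
      (fun A φ _ _ hA hφ _ _ _ ↦ h3 d hd A φ hA hφ)
  exact Ring2.Habitat.weilClassesComponent_two_of_weilAlgebraicAll h2 δ

end Summit.HodgeConjecture.HodgeConjecture.Ring2.AbelianAll
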